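import Summits.QuantumAdvantage.QuantumAdvantage.Theorems.CubicForrelationNearExactIsExactZeroModSixSecondTypeO
import Summits.QuantumAdvantage.QuantumAdvantage.Theorems.CubicForrelationNearExactIsExactZeroModSixSecondLevelOne
import Summits.QuantumAdvantage.QuantumAdvantage.Theorems.CubicForrelationNearExactIsExactZeroModSixSecondLevelTwo
import Summits.QuantumAdvantage.QuantumAdvantage.Theorems.CubicForrelationNearExactIsExactFourteenBoundary
import Summits.QuantumAdvantage.QuantumAdvantage.Theorems.CubicForrelationNearExactIsExactLadderEnvelope

/-!
# Crux `CubicForrelation.NearExactIsExact` (stmt-QuantumAdvantage-14043) — for EVERY `n ≡ 0 (mod 6)`, `n ≥ 18`: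
  `Φ ≥ 1 − 2^{−n/3} ⇒ Φ = 1`, i.e. `θ_n < 1 − 2^{−n/3}` (the SECOND dyadic boundary is not attained)

Certificate seat `b2b-cforr-cert` (gen 8).  HONEST FRAMING: a theorem uniform in `n` over the residue class `n ≡ 0 (mod 6)` — infinitely many
finite-slice verdicts at once; NOT summit progress (the constants `1 − 2^{−n/3}` tend to `1`, while the crux asks for ONE `θ < 1`).  It DOUBLES
the excluded window of the tree's `isolation_rate_closed_zero_mod_six` (`1 − 2^{−n/3−1}`, gen 6) on this class; `n = 18` recovers the tree's
`isolation_eighteen_closed` (`63/64`); NEW rows: `θ₂₄ < 255/256` (tree: `< 511/512`), `θ₃₀ < 1023/1024` (tree: `< 2047/2048`), …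

On `n = 6r` bits write `W_g = 2^{2r}u` (Ax); the parity of `u` is constant (tower).  With `s = (−1)^f`, `τ = u − 2^r s`, the budget
`Σ τ² = 2^{8r+1}(1−Φ) ≤ 2^{6r+1} = 2N` at `Φ ≥ 1 − 2^{−2r}` and the pairing `Σ_y (−1)^g τ̂(y) = 2^{10r}(1−Φ)`:
* type O (all `u` odd): `z2_typeO_lt` (`…ZeroModSixSecondTypeO`; digits `d₁` affine / `d₂` cubic and NO CASE A from `…ZeroModSixDigits`);
* level `2r+1` (`u = 2u'`, some `u'` odd): `z2_levelOne_false` (`…ZeroModSixSecondLevelOne`);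
* level `≥ 2r+2` (`u = 4u''`): `z2_levelTwo_ge` (`…ZeroModSixSecondLevelTwo`; the walk `z2_high_levels` above).
Hence `z2_isolation_ge` (`r ≥ 3`) and, at the literal type `Fin n`, `isolation_closed_zero_mod_six_sharp`, `theta_lt_sharp_zero_mod_six`,
`theta_halfopen_zero_mod_six_sharp` (`θ_n ∈ [15/16, 1 − 2^{−n/3})`), and the explicit rows `isolation_twentyfour_closed` (`255/256`),
`theta_twentyfour_halfopen`, `isolation_thirty_closed` (`1023/1024`).  At `r = 2` (`n = 12`) the type-O step fails (capacity `15/16` is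
attained by non-bent cubics, `Negative/CapTightTwelve.lean`), so `θ₁₂ < 15/16` stays open.

References: J. Ax (1964) / R. J. McEliece (1972); X.-D. Hou (1998); MacWilliams–Sloane (1977) Ch. 13–15; R. O'Donnell (2014) §3.3.
Everything below is proved from Mathlib and the tree; axioms are the standard three.
-/

set_option linter.dupNamespace false -- D-0017: single-problem summit ⇒ `QuantumAdvantage.QuantumAdvantage` by design

noncomputable section

namespace Summit.QuantumAdvantage.QuantumAdvantage.Theorems.CubicForrelation.NearExactIsExact

open Finset
open Literature.Computability.QuantumComplexity
open Literature.Computability.QuantumComplexity.DerivativeWalsh (W)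

/-- **`Φ ≥ 1 − 2^{−2r} ⇒ Φ = 1` for cubic pairs on `3r + 3r` bits, every `r ≥ 3`.**  Type O: `z2_typeO_lt`; level `2r+1`: `z2_levelOne_false`;
level `≥ 2r+2`: `z2_levelTwo_ge`.  Uniform in `r`; NOT summit progress. [this work] -/
theorem z2_isolation_ge (r : ℕ) (hr : 3 ≤ r) (f g : (Fin (3 * r + 3 * r) → Bool) → Bool) (hf : IsDegLeFun 3 f)
    (hg : IsDegLeFun 3 g) (hΦ : 1 - (1 / 2 : ℝ) ^ (2 * r) ≤ forrelation f g) : forrelation f g = 1 := by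
  obtain ⟨u, hu⟩ := tw_base g hg (2 * r) (by omega)
  by_cases hodd : ∃ x, Odd (u x)
  · obtain ⟨x₀, hx₀⟩ := hodd
    have hdeg := stub_walshTower stub_axParity (3 * r + 3 * r) (2 * r) 0 g u hg hu (by intro k hk hkn; omega)
    have hall : ∀ x, Odd (u x) := by
      intro x
      have hc := tc_const_of_deg_zero hdeg x x₀
      rw [decide_eq_true hx₀] at hc
      exact of_decide_eq_true hc
    exact absurd hΦ (not_le.2 (z2_typeO_lt r hr f g hf hg u hu hall))
  · push Not at hodd
    have hu1 := tw_level_up g u hu hodd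
    by_cases hodd1 : ∃ x, Odd (u x / 2)
    · exact (z2_levelOne_false r (by omega) f g hf hg _ hu1 hodd1 hΦ).elim
    · push Not at hodd1
      have hu2 := tw_level_up g _ hu1 hodd1
      exact z2_levelTwo_ge r hr f g hf hg _ hu2 hΦ

/-- **For every `n ≡ 0 (mod 6)`, `n ≥ 18`, and all cubic `f, g : 𝔽₂ⁿ → 𝔽₂: `Φ(f,g) ≥ 1 − 2^{−n/3} ⇒ Φ(f,g) = 1`** (at the literal
type `Fin n`).  Doubles the excluded window of `isolation_rate_closed_zero_mod_six` on this class.  Infinitely many finite-slice verdicts; NOT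
summit progress. [this work] -/
theorem isolation_closed_zero_mod_six_sharp : ∀ n : ℕ, n % 6 = 0 → 18 ≤ n → ∀ f g : (Fin n → Bool) → Bool,
    IsDegLeFun 3 f → IsDegLeFun 3 g → 1 - (1 / 2 : ℝ) ^ (n / 3) ≤ forrelation f g → forrelation f g = 1 := by
  intro n hn h18 f g hf hg hΦ
  obtain ⟨r, hr⟩ : ∃ r, n = 3 * r + 3 * r := ⟨n / 6, by omega⟩
  subst hr
  have e : (3 * r + 3 * r) / 3 = 2 * r := by omega
  rw [e] at hΦ
  exact z2_isolation_ge r (by omega) f g hf hg hΦ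

/-- **`θ_n < 1 − 2^{−n/3}` for every `n ≡ 0 (mod 6)`, `n ≥ 18`.** NOT summit progress. [this work] -/
theorem theta_lt_sharp_zero_mod_six (n : ℕ) (hn : n % 6 = 0) (h18 : 18 ≤ n) :
    ∃ θ : ℝ, θ < 1 - (1 / 2 : ℝ) ^ (n / 3) ∧ ∀ f g : (Fin n → Bool) → Bool, IsDegLeFun 3 f → IsDegLeFun 3 g →
      θ < forrelation f g → forrelation f g = 1 :=
  fb_theta_lt_of_closed (n := n) _ (isolation_closed_zero_mod_six_sharp n hn h18)

/-- **`θ_n ∈ [15/16, 1 − 2^{−n/3})` for every `n ≡ 0 (mod 6)`, `n ≥ 18`** (the least isolating threshold exists, is at least `15/16` by the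
padded `n = 16` witness, and lies strictly below the second dyadic boundary).  NOT summit progress. [this work] -/
theorem theta_halfopen_zero_mod_six_sharp (n : ℕ) (hn : n % 6 = 0) (h18 : 18 ≤ n) :
    ∃ θ₀ : ℝ, 15 / 16 ≤ θ₀ ∧ θ₀ < 1 - (1 / 2 : ℝ) ^ (n / 3) ∧
      IsLeast {θ : ℝ | ∀ f g : (Fin n → Bool) → Bool, IsDegLeFun 3 f → IsDegLeFun 3 g →
        θ < forrelation f g → forrelation f g = 1} θ₀ := by
  obtain ⟨θ₀, hθ₀⟩ := theta_exists n
  obtain ⟨θ', hθ', hiso⟩ := theta_lt_sharp_zero_mod_six n hn h18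
  have hev : Even n := ⟨n / 2, by omega⟩
  exact ⟨θ₀, le_of_isolates_ge_sixteen hev (by omega) hθ₀.1, lt_of_le_of_lt (hθ₀.2 hiso) hθ', hθ₀⟩

/-! ### Explicit new rows: `n = 24` and `n = 30` -/

/-- **On 24 bits, `Φ ≥ 255/256 ⇒ Φ = 1`** for all cubic `f, g : 𝔽₂²⁴ → 𝔽₂ (the tree had `511/512`, `isolation_rate_closed`).  A decidable
verdict about the finite slice `n = 24`; NOT summit progress. [this work] -/
theorem isolation_twentyfour_closed : ∀ f g : (Fin 24 → Bool) → Bool, IsDegLeFun 3 f → IsDegLeFun 3 g →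
    (255 / 256 : ℝ) ≤ forrelation f g → forrelation f g = 1 := by
  intro f g hf hg hΦ
  exact isolation_closed_zero_mod_six_sharp 24 (by norm_num) (by norm_num) f g hf hg (by norm_num; exact hΦ)

/-- **`θ₂₄ ∈ [15/16, 255/256)`.** NOT summit progress. [this work] -/
theorem theta_twentyfour_halfopen : ∃ θ₀ : ℝ, 15 / 16 ≤ θ₀ ∧ θ₀ < 255 / 256 ∧
    IsLeast {θ : ℝ | ∀ f g : (Fin 24 → Bool) → Bool, IsDegLeFun 3 f → IsDegLeFun 3 g →
      θ < forrelation f g → forrelation f g = 1} θ₀ := by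
  obtain ⟨θ₀, h1, h2, h3⟩ := theta_halfopen_zero_mod_six_sharp 24 (by norm_num) (by norm_num)
  exact ⟨θ₀, h1, by norm_num at h2; exact h2, h3⟩

/-- **On 30 bits, `Φ ≥ 1023/1024 ⇒ Φ = 1`** for all cubic `f, g : 𝔽₂³⁰ → 𝔽₂ (the tree had `2047/2048`).  NOT summit progress. [this work] -/
theorem isolation_thirty_closed : ∀ f g : (Fin 30 → Bool) → Bool, IsDegLeFun 3 f → IsDegLeFun 3 g →
    (1023 / 1024 : ℝ) ≤ forrelation f g → forrelation f g = 1 := by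
  intro f g hf hg hΦ
  exact isolation_closed_zero_mod_six_sharp 30 (by norm_num) (by norm_num) f g hf hg (by norm_num; exact hΦ)

end Summit.QuantumAdvantage.QuantumAdvantage.Theorems.CubicForrelation.NearExactIsExact

end
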